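import Mathlib.Algebra.Order.BigOperators.Ring.Finset
import Mathlib.Analysis.Complex.Basic
import Literature.Computability.QuantumComplexity.QueryHybridBound
import Literature.Computability.QuantumComplexity.InfluenceBounds
import HarnessLib

/-!
# The adversary bound on the sensitivity graph: `λ`-type sums are `O(Q(f))`

Aaronson–Ben-David–Kothari–Rao–Tal, *Degree vs. approximate degree and quantum implications of
Huang's sensitivity theorem*, STOC 2021, **Lemma 7**: "For all (partial) Boolean functions `f`,
`λ(f) ≤ SA(f) = O(Q(f))`", proved there by taking the adjacency matrix of the sensitivity graph
`G_f` as the adversary matrix `Γ` in the spectral adversary method of Barnum–Saks–Szegedy ("for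
any `i ∈ [n]`, `Γ ∘ D_i` is the restriction of the sensitive edges in direction `i`. The maximum
degree in the graph represented by `Γ ∘ D_i` is `1` hence `‖Γ ∘ D_i‖` is at most `1`") together
with `Q(f) = Ω(SA(f))` [BSS03].

We prove the resulting inequality directly for the tree's query model `QQueryAlg`
(`QuantumQuery.lean`), in Rayleigh-quotient form (which is all that `λ(f) = ‖A_f‖` is used for):
for every nonnegative unit vector `δ` on `{0,1}ᴺ` and every algorithm `A` computing `f` with
error `1/3`,

  `∑_x ∑_{i : f(x) ≠ f(x^i)} δ_x δ_{x^i} ≤ 144 · T`   (`adversary_sum_le`),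

hence `≤ 144 · Q₂(f)` (`adversary_sum_le_quantumQueryComplexity`). The proof is the
progress-function argument of the spectral method as printed by Høyer–Špalek (*Lower bounds on
quantum query complexity*, 2005, §4, proof of Thm. 2): with `|ψ_x^t⟩` the state after `t`
queries on input `x` and `W^t = ∑_{x,y} Γ[x,y] δ_x δ_y ⟨ψ_x^t|ψ_y^t⟩` (`progress`),
* "The algorithm starts in a quantum state … independent of the oracle `x`, and thus the total
  initial weight is `W⁰ = ∑ Γ[x,y] δ_x δ_y`" (`progress_const`);
* "If `F(x) ≠ F(y)`, we must have that `|⟨ψ_x^T|ψ_y^T⟩| ≤ ε'`, and hence `W^T ≤ ε' W⁰`"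
  (`rinner_le_of_gap`, `progress_final_le`; we use the elementary bound
  `Re⟨ψ_x^T|ψ_y^T⟩ ≤ 1 - 1/72` obtained from `|P_x - P_y| ≥ 1/3` by Cauchy–Schwarz, in place of the
  optimal `ε' = 2√(ε(1-ε))` of their Fact 1);
* "the `t+1`st query changes the inner product by at most the overlap between the projections of
  the two states onto the subspace that corresponds to indices `i` on which `x_i` and `y_i`
  differ … `|W^t - W^{t+1}| ≤ 2 ∑_i a_i^* Γ_i a_i ≤ 2 max_i λ(Γ_i)`" (`rinner_sub_rinner_oracle`,
  `weighted_abs_sub_le`, `progress_sub_progress_step_le`): here `Γ_i` is a matching, and the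
  bound `λ(Γ_i) ≤ 1` is replaced by the inequality `2ab ≤ a² + b²` edge by edge;
* so `(1/72) W⁰ ≤ W⁰ - W^T ≤ 2T` (`adversary_sum_le`, via the `Fin.foldl` invariant principle
  `foldl_invariant` / `foldl_pi` of `PolynomialMethod.lean`).

The oracle of `QQueryAlg` is the bit-flip oracle `|i,b,z⟩ ↦ |i, b ⊕ x_i, z⟩` rather than the
phase oracle of Høyer–Špalek; the argument is identical (both act within the query-index fibres
and agree on the fibres `i` with `x_i = y_i`). No spectral theory (norms of `Γ`, `Γ_i`, principal
eigenvectors) is needed or developed. No named facts are introduced.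

Scope: ABKRT state Lemma 7 for PARTIAL functions; we prove the total case
(`ComputesWithError (1/3) Set.univ f`), which is what Def. 5 (`λ(f)` for total `f`) and the S12
consumer `detQueryComplexity_le_pow_four` need — the proof generalises verbatim to a promise set
with the edges restricted to it.

Design / refactor note. The hypercube neighbour `x^i` is the tree's `flipBit i x`
(`AaronsonAmbainis.lean`, with `sum_flipBit` of `InfluenceBounds.lean`); the bridge to the block
vocabulary of `Complexity/BlockSensitivity.lean` is `flipBit_eq_flipBlock_singleton`
(`x^i = flipBlock x {i}`, so that `f x ≠ f (x^i)` is `IsSensitiveBlock f x {i}`). The helpers live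
in the sub-namespace `SpectralAdversary`: the squared norm `nsq` and real inner product `rinner`
of amplitude vectors, the per-index query weight `fiberWeight`, the edge weights and the progress
function. Two of them overlap with the sibling `QueryHybridBound.lean` (BBBV hybrid argument,
landed concurrently): `nsq a = l2Norm' a ^ 2` (`SpectralAdversary.nsq_eq_l2Norm'_sq`) and
`fiberWeight a i = queryMagnitude {i} a` (`SpectralAdversary.fiberWeight_eq_queryMagnitude`);
likewise the unit-norm invariant re-derived inside `adversary_sum_le` is `l2Norm'_stateAt` there,
and the Cauchy–Schwarz half of `rinner_le_of_gap` is its `abs_acceptProb_sub_le`. The present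
proof is kept self-contained on `nsq`/`rinner` (the inner-product identities `rinner_self`,
`nsq_sub`, `rinner_mulVec_of_mem_unitaryGroup` have no `l2Norm'` counterpart); a librarian may
merge the two APIs through the bridge lemmas (refactor: `nsq ↦ l2Norm' ^ 2`,
`fiberWeight ↦ queryMagnitude {·}`, fold invariant ↦ `stateAt`).

## References

* S. Aaronson, S. Ben-David, R. Kothari, S. Rao, A. Tal, STOC 2021 (arXiv:2010.12629), Def. 6,
  Lemma 7 [AaronsonBenDavidKothariRaoTal2021].
* P. Høyer, R. Špalek, *Lower bounds on quantum query complexity*, Bull. EATCS 87 (2005)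
  (arXiv:quant-ph/0509153), §3 Fact 1, §4 eq. (6)–(11) and Thm. 2 (spectral method of
  Barnum–Saks–Szegedy 2003) [HoyerSpalek2005].
* R. Beals et al., J. ACM 48 (2001), §2 (the query model `QQueryAlg`) [BealsEtAl2001].
-/

noncomputable section

namespace Literature.Computability.QuantumComplexity

open Matrix Finset Literature.Computability.Cryptography

variable {N : ℕ}

namespace SpectralAdversary

/-! ### The hypercube neighbour `x^i = flipBit i x` -/

/-- `(x^i)_i = ¬ x_i`. [folklore] -/
@[simp] theorem flipBit_apply_self (x : Fin N → Bool) (i : Fin N) : flipBit i x i = !x i := by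
  simp [flipBit]

/-- `(x^i)_j = x_j` for `j ≠ i`. [folklore] -/
@[simp] theorem flipBit_apply_of_ne (x : Fin N → Bool) {i j : Fin N} (h : j ≠ i) :
    flipBit i x j = x j := by
  simp [flipBit, h]

/-- **Bridge to the block vocabulary**: `x^i = flipBlock x {i}` (`Complexity/BlockSensitivity.lean`),
so that `f x ≠ f (flipBit i x)` is `Complexity.IsSensitiveBlock f x {i}`. [folklore] -/
theorem flipBit_eq_flipBlock_singleton (i : Fin N) (x : Fin N → Bool) :
    flipBit i x = Complexity.flipBlock x {i} := by
  funext j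
  by_cases h : j = i
  · subst h; simp [Complexity.flipBlock]
  · simp [h, Complexity.flipBlock]

/-! ### Squared norms and real inner products of amplitude vectors -/

section Vec

variable {S : Type*} [Fintype S]

/-- `‖a‖² = ∑_s |a_s|²`. [folklore] -/
def nsq (a : S → ℂ) : ℝ := ∑ s, ‖a s‖ ^ 2

/-- `Re ⟨a|b⟩ = ∑_s Re (conj a_s · b_s)`. [folklore] -/
def rinner (a b : S → ℂ) : ℝ := ∑ s, ((starRingEnd ℂ) (a s) * b s).re

/-- `Re (conj u · v) = u_re v_re + u_im v_im`. [folklore] -/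
theorem re_conj_mul (u v : ℂ) : ((starRingEnd ℂ) u * v).re = u.re * v.re + u.im * v.im := by
  simp [Complex.mul_re]

/-- `|u|² = u_re² + u_im²`. [folklore] -/
theorem norm_sq_eq_re_im (u : ℂ) : ‖u‖ ^ 2 = u.re * u.re + u.im * u.im := by
  rw [Complex.sq_norm, Complex.normSq_apply]

/-- `Re ⟨a|a⟩ = ‖a‖²`. [folklore] -/
theorem rinner_self (a : S → ℂ) : rinner a a = nsq a := by
  unfold rinner nsq
  refine Finset.sum_congr rfl fun s _ => ?_
  rw [re_conj_mul, norm_sq_eq_re_im]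

/-- `Re ⟨a|b⟩` is symmetric. [folklore] -/
theorem rinner_comm (a b : S → ℂ) : rinner a b = rinner b a := by
  unfold rinner
  refine Finset.sum_congr rfl fun s _ => ?_
  rw [re_conj_mul, re_conj_mul]; ring

/-- `‖a - b‖² = ‖a‖² + ‖b‖² - 2 Re ⟨a|b⟩`. [folklore] -/
theorem nsq_sub (a b : S → ℂ) : nsq (a - b) = nsq a + nsq b - 2 * rinner a b := by
  unfold nsq rinner
  rw [Finset.mul_sum, ← Finset.sum_add_distrib, ← Finset.sum_sub_distrib]
  refine Finset.sum_congr rfl fun s _ => ?_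
  simp only [Pi.sub_apply, norm_sq_eq_re_im, re_conj_mul, Complex.sub_re, Complex.sub_im]
  ring

/-- `nsq` is nonnegative. [folklore] -/
theorem nsq_nonneg (a : S → ℂ) : 0 ≤ nsq a := Finset.sum_nonneg fun _ _ => by positivity

/-- `|Re (conj u · v)| ≤ |u| |v|`. [folklore] -/
theorem abs_re_conj_mul_le (u v : ℂ) : |((starRingEnd ℂ) u * v).re| ≤ ‖u‖ * ‖v‖ :=
  (Complex.abs_re_le_norm _).trans (by rw [norm_mul, Complex.norm_conj])

/-- `Re ⟨a|b⟩` is the real part of the complex inner product `star a ⬝ᵥ b`. [folklore] -/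
theorem rinner_eq_re_dotProduct (a b : S → ℂ) : rinner a b = (star a ⬝ᵥ b).re := by
  simp only [rinner, dotProduct, Pi.star_apply, Complex.re_sum, Complex.star_def]

/-- "A unitary operator is just a change of basis, it does not change the inner product between
any two quantum states." [cite: HoyerSpalek2005, §3 (before §4)] -/
theorem rinner_mulVec_of_mem_unitaryGroup [DecidableEq S] {U : Matrix S S ℂ}
    (hU : U ∈ Matrix.unitaryGroup S ℂ) (a b : S → ℂ) :
    rinner (U *ᵥ a) (U *ᵥ b) = rinner a b := by
  have h1 : Uᴴ * U = 1 := by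
    simpa [Matrix.star_eq_conjTranspose] using Matrix.mem_unitaryGroup_iff'.mp hU
  rw [rinner_eq_re_dotProduct, rinner_eq_re_dotProduct, star_mulVec, dotProduct_mulVec,
    vecMul_vecMul, h1, vecMul_one]

/-- Unitaries preserve `‖·‖²`. [cite: BealsEtAl2001, §2] -/
theorem nsq_mulVec_of_mem_unitaryGroup [DecidableEq S] {U : Matrix S S ℂ}
    (hU : U ∈ Matrix.unitaryGroup S ℂ) (a : S → ℂ) : nsq (U *ᵥ a) = nsq a :=
  sum_norm_sq_mulVec_of_mem_unitaryGroup hU a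

/-! ### Distinguishable final states have inner product bounded away from `1` -/

/-- **Distinguishing forces a gap in the inner product** (the role of Høyer–Špalek's Fact 1): if
two unit vectors have acceptance probabilities (on the same accepting set) differing by at least
`1/3`, then `Re ⟨a|b⟩ ≤ 1 - 1/72`. Proof: `|P_a - P_b| ≤ ∑ | |a_s|² - |b_s|² | ≤
∑ |a_s - b_s| (|a_s| + |b_s|) ≤ 2 ‖a - b‖` by Cauchy–Schwarz, and `‖a - b‖² = 2 - 2 Re ⟨a|b⟩`.
[cite: HoyerSpalek2005, §3 Fact 1 and §4 ("W^T ≤ ε' W⁰")] -/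
theorem rinner_le_of_gap (acc : Finset S) {a b : S → ℂ} (ha : nsq a = 1) (hb : nsq b = 1)
    (hgap : 1 / 3 ≤ |∑ s ∈ acc, ‖a s‖ ^ 2 - ∑ s ∈ acc, ‖b s‖ ^ 2|) :
    rinner a b ≤ 1 - 1 / 72 := by
  -- `|P_a - P_b| ≤ ∑_acc |a_s - b_s| (|a_s| + |b_s|)`
  have h1 : |∑ s ∈ acc, ‖a s‖ ^ 2 - ∑ s ∈ acc, ‖b s‖ ^ 2| ≤
      ∑ s ∈ acc, ‖a s - b s‖ * (‖a s‖ + ‖b s‖) := by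
    rw [← Finset.sum_sub_distrib]
    refine (Finset.abs_sum_le_sum_abs _ _).trans (Finset.sum_le_sum fun s _ => ?_)
    have e : ‖a s‖ ^ 2 - ‖b s‖ ^ 2 = (‖a s‖ - ‖b s‖) * (‖a s‖ + ‖b s‖) := by ring
    rw [e, abs_mul, abs_of_nonneg (by positivity : 0 ≤ ‖a s‖ + ‖b s‖)]
    exact mul_le_mul_of_nonneg_right (abs_norm_sub_norm_le _ _) (by positivity)
  -- Cauchy–Schwarz, squared
  have h2 : (∑ s ∈ acc, ‖a s - b s‖ * (‖a s‖ + ‖b s‖)) ^ 2 ≤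
      (∑ s ∈ acc, ‖a s - b s‖ ^ 2) * ∑ s ∈ acc, (‖a s‖ + ‖b s‖) ^ 2 :=
    Finset.sum_mul_sq_le_sq_mul_sq _ _ _
  have h3 : ∑ s ∈ acc, ‖a s - b s‖ ^ 2 ≤ nsq (a - b) := by
    unfold nsq
    exact Finset.sum_le_univ_sum_of_nonneg fun s => by positivity
  have h4 : ∑ s ∈ acc, (‖a s‖ + ‖b s‖) ^ 2 ≤ 4 := by
    calc ∑ s ∈ acc, (‖a s‖ + ‖b s‖) ^ 2 ≤ ∑ s, (‖a s‖ + ‖b s‖) ^ 2 :=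
          Finset.sum_le_univ_sum_of_nonneg fun s => by positivity
      _ ≤ ∑ s, (2 * ‖a s‖ ^ 2 + 2 * ‖b s‖ ^ 2) :=
          Finset.sum_le_sum fun s _ => by nlinarith [sq_nonneg (‖a s‖ - ‖b s‖)]
      _ = 2 * nsq a + 2 * nsq b := by
          rw [Finset.sum_add_distrib, nsq, nsq, Finset.mul_sum, Finset.mul_sum]
      _ = 4 := by rw [ha, hb]; norm_num
  have h5 : nsq (a - b) = 2 - 2 * rinner a b := by rw [nsq_sub, ha, hb]; ring
  have hsq : (1 / 3 : ℝ) ^ 2 ≤ (∑ s ∈ acc, ‖a s - b s‖ * (‖a s‖ + ‖b s‖)) ^ 2 :=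
    pow_le_pow_left₀ (by norm_num) (hgap.trans h1) 2
  have hab : 0 ≤ nsq (a - b) := nsq_nonneg _
  have h6 : (1 / 3 : ℝ) ^ 2 ≤ nsq (a - b) * 4 := by
    refine hsq.trans (h2.trans ?_)
    exact mul_le_mul h3 h4 (Finset.sum_nonneg fun _ _ => by positivity) hab
  rw [h5] at h6
  nlinarith

end Vec

/-! ### One query changes the progress by little -/

section Oracle

variable {W : Type*} [Fintype W]

/-- The query weight of index `i`: `β_{x,i}² = ‖P_i ψ‖² = ∑_{b,z} |ψ(i,b,z)|²` ("the absolute value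
of the amplitude of querying the `i`th bit", squared). [cite: HoyerSpalek2005, §4 (proof of Thm. 2)] -/
def fiberWeight (a : Fin N × Bool × W → ℂ) (i : Fin N) : ℝ := ∑ b : Bool, ∑ z : W, ‖a (i, b, z)‖ ^ 2

/-- `fiberWeight` is nonnegative. [folklore] -/
theorem fiberWeight_nonneg (a : Fin N × Bool × W → ℂ) (i : Fin N) : 0 ≤ fiberWeight a i :=
  Finset.sum_nonneg fun _ _ => Finset.sum_nonneg fun _ _ => by positivity

/-- "`∑_i β_{x,i}² = 1` for any oracle `x`": the query weights sum to `‖ψ‖²`. [cite: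
HoyerSpalek2005, §4 (proof of Thm. 2)] -/
theorem sum_fiberWeight (a : Fin N × Bool × W → ℂ) : ∑ i, fiberWeight a i = nsq a := by
  unfold fiberWeight nsq
  rw [Fintype.sum_prod_type]
  refine Finset.sum_congr rfl fun i _ => ?_
  rw [Fintype.sum_prod_type]

variable [DecidableEq W]

/-- Reindexing the target bit by `b ↦ b ⊕ c`. [folklore] -/
theorem sum_bool_xor {α : Type*} [AddCommMonoid α] (c : Bool) (g : Bool → α) :
    ∑ b, g (b ^^ c) = ∑ b, g b := by
  cases c
  · simp
  · rw [Fintype.sum_bool, Fintype.sum_bool]; simp [add_comm]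

/-- **The change of one inner product under one query** (Høyer–Špalek eq. (11), bit-flip oracle):
for `y = x^i`, `⟨a|b⟩ - ⟨O_x a|O_y b⟩` only involves the fibre of query index `i` (on the other
fibres `O_x` and `O_y` agree and are bijections). [cite: HoyerSpalek2005, §4 eq. (11)] -/
theorem rinner_sub_rinner_oracle (x : Fin N → Bool) (i : Fin N)
    (a b : Fin N × Bool × W → ℂ) :
    rinner a b - rinner (queryOracle x *ᵥ a) (queryOracle (flipBit i x) *ᵥ b) =
      (∑ bb : Bool, ∑ z : W, ((starRingEnd ℂ) (a (i, bb, z)) * b (i, bb, z)).re) -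
        ∑ bb : Bool, ∑ z : W,
          ((starRingEnd ℂ) (a (i, (bb ^^ x i), z)) * b (i, (bb ^^ !x i), z)).re := by
  unfold rinner
  simp only [queryOracle_mulVec_apply]
  rw [Fintype.sum_prod_type, Fintype.sum_prod_type, ← Finset.sum_sub_distrib]
  simp only [Fintype.sum_prod_type]
  rw [← Finset.sum_sub_distrib]
  have key : ∀ i' : Fin N,
      ((∑ bb : Bool, ∑ z : W, ((starRingEnd ℂ) (a (i', bb, z)) * b (i', bb, z)).re) -
        ∑ bb : Bool, ∑ z : W, ((starRingEnd ℂ) (a (i', (bb ^^ x i'), z)) *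
          b (i', (bb ^^ flipBit i x i'), z)).re) =
      if i' = i then
        (∑ bb : Bool, ∑ z : W, ((starRingEnd ℂ) (a (i, bb, z)) * b (i, bb, z)).re) -
          ∑ bb : Bool, ∑ z : W,
            ((starRingEnd ℂ) (a (i, (bb ^^ x i), z)) * b (i, (bb ^^ !x i), z)).re
      else 0 := by
    intro i'
    split_ifs with h
    · subst h; simp
    · rw [flipBit_apply_of_ne x h, sub_eq_zero]
      exact (sum_bool_xor (x i') fun bb => ∑ z : W,
        ((starRingEnd ℂ) (a (i', bb, z)) * b (i', bb, z)).re).symm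
  rw [Finset.sum_congr rfl fun i' _ => key i', Finset.sum_ite_eq' Finset.univ i]
  simp

/-- `2 δ δ' |u| |v| ≤ δ² |u|² + δ'² |v|²`. [folklore] -/
theorem two_mul_weights_le (δ δ' p q : ℝ) : 2 * (δ * δ' * (p * q)) ≤ δ ^ 2 * p ^ 2 + δ' ^ 2 * q ^ 2 := by
  nlinarith [sq_nonneg (δ * p - δ' * q)]

/-- **Weighted one-query bound on one edge**: for `y = x^i` and nonnegative weights,
`δ_x δ_y |⟨a|b⟩ - ⟨O_x a|O_y b⟩| ≤ δ_x² β_{a,i}² + δ_y² β_{b,i}²` (Høyer–Špalek's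
`≤ 2 β_{x,i} β_{y,i}` followed by `2uv ≤ u² + v²`). [cite: HoyerSpalek2005, §4 eq. (11)] -/
theorem weighted_abs_sub_le (x : Fin N → Bool) (i : Fin N) (a b : Fin N × Bool × W → ℂ)
    {δx δy : ℝ} (hδx : 0 ≤ δx) (hδy : 0 ≤ δy) :
    δx * δy * |rinner a b - rinner (queryOracle x *ᵥ a) (queryOracle (flipBit i x) *ᵥ b)| ≤
      δx ^ 2 * fiberWeight a i + δy ^ 2 * fiberWeight b i := by
  rw [rinner_sub_rinner_oracle]
  set T₁ := ∑ bb : Bool, ∑ z : W, ((starRingEnd ℂ) (a (i, bb, z)) * b (i, bb, z)).re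
  set T₂ := ∑ bb : Bool, ∑ z : W,
    ((starRingEnd ℂ) (a (i, (bb ^^ x i), z)) * b (i, (bb ^^ !x i), z)).re
  -- each of the two sums is bounded by `(δx² β_a + δy² β_b) / 2` after weighting
  have hT₁ : δx * δy * |T₁| ≤ (δx ^ 2 * fiberWeight a i + δy ^ 2 * fiberWeight b i) / 2 := by
    have h : |T₁| ≤ ∑ bb : Bool, ∑ z : W, ‖a (i, bb, z)‖ * ‖b (i, bb, z)‖ := by
      refine (Finset.abs_sum_le_sum_abs _ _).trans (Finset.sum_le_sum fun bb _ => ?_)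
      exact (Finset.abs_sum_le_sum_abs _ _).trans
        (Finset.sum_le_sum fun z _ => abs_re_conj_mul_le _ _)
    calc δx * δy * |T₁| ≤ δx * δy * ∑ bb : Bool, ∑ z : W, ‖a (i, bb, z)‖ * ‖b (i, bb, z)‖ :=
          mul_le_mul_of_nonneg_left h (mul_nonneg hδx hδy)
      _ = ∑ bb : Bool, ∑ z : W, δx * δy * (‖a (i, bb, z)‖ * ‖b (i, bb, z)‖) := by
          rw [Finset.mul_sum]; refine Finset.sum_congr rfl fun bb _ => ?_; rw [Finset.mul_sum]
      _ ≤ ∑ bb : Bool, ∑ z : W,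
            (δx ^ 2 * ‖a (i, bb, z)‖ ^ 2 + δy ^ 2 * ‖b (i, bb, z)‖ ^ 2) / 2 :=
          Finset.sum_le_sum fun bb _ => Finset.sum_le_sum fun z _ => by
            linarith [two_mul_weights_le δx δy ‖a (i, bb, z)‖ ‖b (i, bb, z)‖]
      _ = (δx ^ 2 * fiberWeight a i + δy ^ 2 * fiberWeight b i) / 2 := by
          unfold fiberWeight
          rw [Finset.mul_sum, Finset.mul_sum, ← Finset.sum_add_distrib, Finset.sum_div]
          refine Finset.sum_congr rfl fun bb _ => ?_
          rw [Finset.mul_sum, Finset.mul_sum, ← Finset.sum_add_distrib, Finset.sum_div]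
  have hT₂ : δx * δy * |T₂| ≤ (δx ^ 2 * fiberWeight a i + δy ^ 2 * fiberWeight b i) / 2 := by
    have h : |T₂| ≤ ∑ bb : Bool, ∑ z : W, ‖a (i, (bb ^^ x i), z)‖ * ‖b (i, (bb ^^ !x i), z)‖ := by
      refine (Finset.abs_sum_le_sum_abs _ _).trans (Finset.sum_le_sum fun bb _ => ?_)
      exact (Finset.abs_sum_le_sum_abs _ _).trans
        (Finset.sum_le_sum fun z _ => abs_re_conj_mul_le _ _)
    have ha : ∑ bb : Bool, ∑ z : W, ‖a (i, (bb ^^ x i), z)‖ ^ 2 = fiberWeight a i :=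
      sum_bool_xor (x i) fun bb => ∑ z : W, ‖a (i, bb, z)‖ ^ 2
    have hb : ∑ bb : Bool, ∑ z : W, ‖b (i, (bb ^^ !x i), z)‖ ^ 2 = fiberWeight b i :=
      sum_bool_xor (!x i) fun bb => ∑ z : W, ‖b (i, bb, z)‖ ^ 2
    calc δx * δy * |T₂|
        ≤ δx * δy * ∑ bb : Bool, ∑ z : W, ‖a (i, (bb ^^ x i), z)‖ * ‖b (i, (bb ^^ !x i), z)‖ :=
          mul_le_mul_of_nonneg_left h (mul_nonneg hδx hδy)
      _ = ∑ bb : Bool, ∑ z : W,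
            δx * δy * (‖a (i, (bb ^^ x i), z)‖ * ‖b (i, (bb ^^ !x i), z)‖) := by
          rw [Finset.mul_sum]; refine Finset.sum_congr rfl fun bb _ => ?_; rw [Finset.mul_sum]
      _ ≤ ∑ bb : Bool, ∑ z : W,
            (δx ^ 2 * ‖a (i, (bb ^^ x i), z)‖ ^ 2 + δy ^ 2 * ‖b (i, (bb ^^ !x i), z)‖ ^ 2) / 2 :=
          Finset.sum_le_sum fun bb _ => Finset.sum_le_sum fun z _ => by
            linarith [two_mul_weights_le δx δy ‖a (i, (bb ^^ x i), z)‖ ‖b (i, (bb ^^ !x i), z)‖]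
      _ = (δx ^ 2 * ∑ bb : Bool, ∑ z : W, ‖a (i, (bb ^^ x i), z)‖ ^ 2 +
            δy ^ 2 * ∑ bb : Bool, ∑ z : W, ‖b (i, (bb ^^ !x i), z)‖ ^ 2) / 2 := by
          rw [Finset.mul_sum, Finset.mul_sum, ← Finset.sum_add_distrib, Finset.sum_div]
          refine Finset.sum_congr rfl fun bb _ => ?_
          rw [Finset.mul_sum, Finset.mul_sum, ← Finset.sum_add_distrib, Finset.sum_div]
      _ = (δx ^ 2 * fiberWeight a i + δy ^ 2 * fiberWeight b i) / 2 := by rw [ha, hb]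
  calc δx * δy * |T₁ - T₂| ≤ δx * δy * (|T₁| + |T₂|) :=
        mul_le_mul_of_nonneg_left (abs_sub _ _) (mul_nonneg hδx hδy)
    _ = δx * δy * |T₁| + δx * δy * |T₂| := by ring
    _ ≤ _ := by linarith

end Oracle

/-! ### The progress function -/

section Progress

variable {W : Type*} [Fintype W]

/-- The weight `Γ[x, x^i] δ_x δ_{x^i}` of the edge `(x, x^i)`: `δ_x δ_{x^i}` on sensitive edges
(`f(x) ≠ f(x^i)`), `0` otherwise — `Γ` "simply the adjacency matrix of `G_f`". [cite:
AaronsonBenDavidKothariRaoTal2021, Lemma 7 (proof)] -/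
def edgeWeight (f : (Fin N → Bool) → Bool) (δ : (Fin N → Bool) → ℝ) (x : Fin N → Bool)
    (i : Fin N) : ℝ :=
  if f x = f (flipBit i x) then 0 else δ x * δ (flipBit i x)

/-- `0 ≤ Γ[x,x^i] δ_x δ_{x^i}` for `δ ≥ 0`. [folklore] -/
theorem edgeWeight_nonneg (f : (Fin N → Bool) → Bool) {δ : (Fin N → Bool) → ℝ}
    (hδ : ∀ x, 0 ≤ δ x) (x : Fin N → Bool) (i : Fin N) : 0 ≤ edgeWeight f δ x i := by
  unfold edgeWeight; split_ifs
  · exact le_rfl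
  · exact mul_nonneg (hδ _) (hδ _)

/-- `Γ[x,x^i] δ_x δ_{x^i} ≤ δ_x δ_{x^i}` for `δ ≥ 0`. [folklore] -/
theorem edgeWeight_le (f : (Fin N → Bool) → Bool) {δ : (Fin N → Bool) → ℝ}
    (hδ : ∀ x, 0 ≤ δ x) (x : Fin N → Bool) (i : Fin N) :
    edgeWeight f δ x i ≤ δ x * δ (flipBit i x) := by
  unfold edgeWeight; split_ifs
  · exact mul_nonneg (hδ _) (hδ _)
  · exact le_rfl

/-- The progress function `W = ∑_{x,y} Γ[x,y] δ_x δ_y Re⟨ψ_x|ψ_y⟩` of a family of states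
`Ψ = (ψ_x)_x`, for `Γ` the adjacency matrix of the sensitivity graph (edges `(x, x^i)` with
`f(x) ≠ f(x^i)`). [cite: HoyerSpalek2005, §4 eq. (7)] -/
def progress (f : (Fin N → Bool) → Bool) (δ : (Fin N → Bool) → ℝ)
    (Ψ : (Fin N → Bool) → Fin N × Bool × W → ℂ) : ℝ :=
  ∑ x, ∑ i, edgeWeight f δ x i * rinner (Ψ x) (Ψ (flipBit i x))

/-- "The algorithm starts in a quantum state … which is independent of the oracle `x`, and thus
the total initial weight is `W⁰ = ∑ Γ[x,y] δ_x δ_y`" (times `‖ψ‖²`). [cite: HoyerSpalek2005, §4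
eq. (8)] -/
theorem progress_const (f : (Fin N → Bool) → Bool) (δ : (Fin N → Bool) → ℝ)
    (v : Fin N × Bool × W → ℂ) :
    progress f δ (fun _ => v) = (∑ x, ∑ i, edgeWeight f δ x i) * nsq v := by
  unfold progress
  rw [Finset.sum_mul]
  refine Finset.sum_congr rfl fun x _ => ?_
  rw [Finset.sum_mul]
  refine Finset.sum_congr rfl fun i _ => ?_
  rw [rinner_self]

/-- **One query costs at most `2`**: for unit states `ψ_x`, a nonnegative unit vector `δ` and any
unitary `U`, `W(Ψ) - W(U O Ψ) ≤ 2` ("`|W^t - W^{t+1}| ≤ 2 ∑_i a_i^* Γ_i a_i ≤ 2 max_i λ(Γ_i)`",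
with `λ(Γ_i) ≤ 1` for the matchings `Γ_i` of the sensitivity graph). [cite: HoyerSpalek2005, §4
(proof of Thm. 2)] -/
theorem progress_sub_progress_step_le [DecidableEq W] (f : (Fin N → Bool) → Bool)
    {δ : (Fin N → Bool) → ℝ}
    (hδ : ∀ x, 0 ≤ δ x) (hδ1 : ∑ x, δ x ^ 2 = 1)
    {U : Matrix (Fin N × Bool × W) (Fin N × Bool × W) ℂ}
    (hU : U ∈ Matrix.unitaryGroup (Fin N × Bool × W) ℂ)
    (Ψ : (Fin N → Bool) → Fin N × Bool × W → ℂ) (hΨ : ∀ x, nsq (Ψ x) = 1) :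
    progress f δ Ψ - progress f δ (fun x => U *ᵥ (queryOracle x *ᵥ Ψ x)) ≤ 2 := by
  unfold progress
  simp only [rinner_mulVec_of_mem_unitaryGroup hU]
  rw [← Finset.sum_sub_distrib]
  simp only [← Finset.sum_sub_distrib, ← mul_sub]
  -- edge by edge
  have hedge : ∀ x i, edgeWeight f δ x i *
      (rinner (Ψ x) (Ψ (flipBit i x)) -
        rinner (queryOracle x *ᵥ Ψ x) (queryOracle (flipBit i x) *ᵥ Ψ (flipBit i x))) ≤
      δ x ^ 2 * fiberWeight (Ψ x) i + δ (flipBit i x) ^ 2 * fiberWeight (Ψ (flipBit i x)) i := by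
    intro x i
    refine le_trans ?_ (weighted_abs_sub_le x i (Ψ x) (Ψ (flipBit i x)) (hδ x) (hδ _))
    refine (le_abs_self _).trans ?_
    rw [abs_mul, abs_of_nonneg (edgeWeight_nonneg f hδ x i)]
    exact mul_le_mul_of_nonneg_right (edgeWeight_le f hδ x i) (abs_nonneg _)
  refine (Finset.sum_le_sum fun x _ => Finset.sum_le_sum fun i _ => hedge x i).trans ?_
  -- `∑_{x,i} δ_x² β_{x,i} = 1` and the same after reindexing `x ↦ x^i`
  have h1 : ∑ x, ∑ i, δ x ^ 2 * fiberWeight (Ψ x) i = 1 := by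
    simp_rw [← Finset.mul_sum, sum_fiberWeight, hΨ, mul_one]
    exact hδ1
  have h2 : ∑ x, ∑ i, δ (flipBit i x) ^ 2 * fiberWeight (Ψ (flipBit i x)) i = 1 := by
    rw [Finset.sum_comm]
    have hre : ∀ i : Fin N, ∑ x, δ (flipBit i x) ^ 2 * fiberWeight (Ψ (flipBit i x)) i =
        ∑ x, δ x ^ 2 * fiberWeight (Ψ x) i :=
      fun i => sum_flipBit i (fun y => δ y ^ 2 * fiberWeight (Ψ y) i)
    rw [Finset.sum_congr rfl fun i _ => hre i, Finset.sum_comm]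
    exact h1
  rw [Finset.sum_congr rfl fun x _ => Finset.sum_add_distrib, Finset.sum_add_distrib, h1, h2]
  norm_num

/-- **The final weight is small**: if the states `ψ_x` are unit vectors whose acceptance
probabilities `∑_{s ∈ acc} |ψ_x(s)|²` compute `f` with error `1/3`, then
`W ≤ (1 - 1/72) ∑ Γ[x,y] δ_x δ_y` ("if `F(x) ≠ F(y)` we must have `|⟨ψ_x^T|ψ_y^T⟩| ≤ ε'`, and
hence `W^T ≤ ε' W⁰`"). [cite: HoyerSpalek2005, §4 (proof of Thm. 2)] -/
theorem progress_final_le (f : (Fin N → Bool) → Bool) {δ : (Fin N → Bool) → ℝ}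
    (hδ : ∀ x, 0 ≤ δ x) (acc : Finset (Fin N × Bool × W))
    (Ψ : (Fin N → Bool) → Fin N × Bool × W → ℂ) (hΨ : ∀ x, nsq (Ψ x) = 1)
    (h1 : ∀ x, f x = true → 2 / 3 ≤ ∑ s ∈ acc, ‖Ψ x s‖ ^ 2)
    (h0 : ∀ x, f x = false → ∑ s ∈ acc, ‖Ψ x s‖ ^ 2 ≤ 1 / 3) :
    progress f δ Ψ ≤ (1 - 1 / 72) * ∑ x, ∑ i, edgeWeight f δ x i := by
  unfold progress
  rw [Finset.mul_sum]
  refine Finset.sum_le_sum fun x _ => ?_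
  rw [Finset.mul_sum]
  refine Finset.sum_le_sum fun i _ => ?_
  rw [mul_comm (1 - 1 / 72 : ℝ)]
  by_cases hxi : f x = f (flipBit i x)
  · simp [edgeWeight, hxi]
  · refine mul_le_mul_of_nonneg_left ?_ (edgeWeight_nonneg f hδ x i)
    refine rinner_le_of_gap acc (hΨ x) (hΨ _) ?_
    -- the acceptance probabilities differ by at least `1/3`
    cases hfx : f x
    · have hfy : f (flipBit i x) = true := by
        cases hfy : f (flipBit i x)
        · exact absurd (hfx.trans hfy.symm) hxi
        · rfl
      have := h0 x hfx; have := h1 _ hfy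
      rw [abs_sub_comm, abs_of_nonneg (by linarith)]
      linarith
    · have hfy : f (flipBit i x) = false := by
        cases hfy : f (flipBit i x)
        · rfl
        · exact absurd (hfx.trans hfy.symm) hxi
      have := h1 x hfx; have := h0 _ hfy
      rw [abs_of_nonneg (by linarith)]
      linarith

end Progress

/-! ### Bridges to `QueryHybridBound.lean` -/

section Bridge

variable {W : Type*} [Fintype W]

/-- `nsq` is the square of the `ℓ²`-norm `l2Norm'` of `QueryHybridBound.lean` (refactor bridge).
[folklore] -/
theorem nsq_eq_l2Norm'_sq {S : Type*} [Fintype S] (a : S → ℂ) : nsq a = l2Norm' a ^ 2 := by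
  rw [l2Norm'_sq]; rfl

/-- `fiberWeight a i` is the query magnitude `queryMagnitude {i} a` of `QueryHybridBound.lean`
(refactor bridge). [folklore] -/
theorem fiberWeight_eq_queryMagnitude (a : Fin N × Bool × W → ℂ) (i : Fin N) :
    fiberWeight a i = queryMagnitude {i} a := by
  unfold fiberWeight queryMagnitude
  rw [Fintype.sum_prod_type]
  simp only [Finset.mem_singleton]
  rw [Finset.sum_eq_single i]
  · simp only [if_true]
    rw [Fintype.sum_prod_type]
  · intro j _ hj
    simp [hj]
  · simp

end Bridge

end SpectralAdversary

open SpectralAdversary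

/-! ### The adversary bound for `QQueryAlg` -/

/-- **The adversary bound on the sensitivity graph** (ABKRT Lemma 7 in Rayleigh-quotient form,
for the model `QQueryAlg`; total functions — the printed lemma also covers partial ones): if `A`
computes the total function `f` with error `1/3` using `T` queries, then for every nonnegative
unit vector `δ` on the cube, `∑_x ∑_{i : f(x) ≠ f(x^i)} δ_x δ_{x^i} ≤ 144 · T`.
[cite: AaronsonBenDavidKothariRaoTal2021, Lemma 7] [cite: HoyerSpalek2005, Thm. 2] -/
theorem adversary_sum_le (A : QQueryAlg N) {f : (Fin N → Bool) → Bool}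
    (hA : A.ComputesWithError (1 / 3) Set.univ f) {δ : (Fin N → Bool) → ℝ}
    (hδ : ∀ x, 0 ≤ δ x) (hδ1 : ∑ x, δ x ^ 2 = 1) :
    ∑ x, ∑ i, edgeWeight f δ x i ≤ 144 * A.queries := by
  classical
  -- the initial state, the initial family and the family-level step
  let v : Fin N × Bool × A.W → ℂ := (A.unitaries 0).1 *ᵥ Pi.single A.start 1
  let Ψ₀ : (Fin N → Bool) → Fin N × Bool × A.W → ℂ := fun _ => v
  let F : ((Fin N → Bool) → Fin N × Bool × A.W → ℂ) → Fin A.queries →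
      ((Fin N → Bool) → Fin N × Bool × A.W → ℂ) :=
    fun Ψ j b => (A.unitaries j.succ).1 *ᵥ (queryOracle b *ᵥ Ψ b)
  -- the family of final states is the fold of the family-level steps
  have hfin : (fun x => A.finalState x) = Fin.foldl A.queries F Ψ₀ :=
    foldl_pi A.queries (fun (x : Fin N → Bool) (ψ : Fin N × Bool × A.W → ℂ)
      (j : Fin A.queries) => (A.unitaries j.succ).1 *ᵥ (queryOracle x *ᵥ ψ)) Ψ₀
  have hv : nsq v = 1 := by
    show nsq ((A.unitaries 0).1 *ᵥ Pi.single A.start (1 : ℂ)) = 1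
    rw [nsq_mulVec_of_mem_unitaryGroup (A.unitaries 0).2]
    unfold nsq
    rw [Finset.sum_eq_single A.start]
    · simp
    · intro s _ hs; simp [hs]
    · simp
  -- the invariant: after `j` rounds, `W⁰ - W ≤ 2j` and all states are unit vectors
  have key : progress f δ Ψ₀ - progress f δ (Fin.foldl A.queries F Ψ₀) ≤ 2 * (A.queries : ℝ) ∧
      ∀ x, nsq (Fin.foldl A.queries F Ψ₀ x) = 1 := by
    refine foldl_invariant A.queries F Ψ₀
      (fun j Ψ => progress f δ Ψ₀ - progress f δ Ψ ≤ 2 * (j : ℝ) ∧ ∀ x, nsq (Ψ x) = 1) ?_ ?_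
    · exact ⟨by simp, fun _ => hv⟩
    · rintro j Ψ ⟨hW, hunit⟩
      refine ⟨?_, fun x => ?_⟩
      · have hstep := progress_sub_progress_step_le f hδ hδ1 (A.unitaries j.succ).2 Ψ hunit
        change progress f δ Ψ₀ -
            progress f δ (fun b => (A.unitaries j.succ).1 *ᵥ (queryOracle b *ᵥ Ψ b)) ≤
          2 * (((j : ℕ) + 1 : ℕ) : ℝ)
        push_cast
        linarith
      · change nsq ((A.unitaries j.succ).1 *ᵥ (queryOracle x *ᵥ Ψ x)) = 1
        rw [nsq_mulVec_of_mem_unitaryGroup (A.unitaries j.succ).2,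
          nsq_mulVec_of_mem_unitaryGroup (queryOracle_mem_unitaryGroup x), hunit x]
  rw [← hfin] at key
  obtain ⟨hW, hunit⟩ := key
  have hunit' : ∀ x, nsq (A.finalState x) = 1 := fun x => hunit x
  -- initial and final weights
  have h0 : progress f δ Ψ₀ = ∑ x, ∑ i, edgeWeight f δ x i := by
    show progress f δ (fun _ => v) = _
    rw [progress_const, hv, mul_one]
  have hacc1 : ∀ x, f x = true → 2 / 3 ≤ ∑ s with s ∈ A.accept, ‖A.finalState x s‖ ^ 2 := by
    intro x hx
    have h := (hA x (Set.mem_univ x)).1 hx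
    rw [QQueryAlg.acceptProb] at h
    linarith
  have hacc0 : ∀ x, f x = false → ∑ s with s ∈ A.accept, ‖A.finalState x s‖ ^ 2 ≤ 1 / 3 := by
    intro x hx
    have h := (hA x (Set.mem_univ x)).2 hx
    rwa [QQueryAlg.acceptProb] at h
  have hT : progress f δ (fun x => A.finalState x) ≤
      (1 - 1 / 72) * ∑ x, ∑ i, edgeWeight f δ x i :=
    progress_final_le f hδ _ _ hunit' hacc1 hacc0
  rw [h0] at hW
  linarith

/-- **ABKRT Lemma 7 / spectral adversary, in terms of `Q₂(f)`** (total functions): for every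
total `f` on `N` bits and every nonnegative unit vector `δ` on the cube,
`∑_x ∑_{i : f(x) ≠ f(x^i)} δ_x δ_{x^i} ≤ 144 · Q₂(f)` with `Q₂ = quantumQueryComplexity (1/3)`
(`λ(f) ≤ 144 Q₂(f)` on taking the supremum over `δ`). [cite: AaronsonBenDavidKothariRaoTal2021, Lemma 7] -/
theorem adversary_sum_le_quantumQueryComplexity (f : (Fin N → Bool) → Bool)
    {δ : (Fin N → Bool) → ℝ} (hδ : ∀ x, 0 ≤ δ x) (hδ1 : ∑ x, δ x ^ 2 = 1) :
    ∑ x, ∑ i, edgeWeight f δ x i ≤ 144 * (quantumQueryComplexity (1 / 3) f : ℝ) := by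
  rcases Nat.eq_zero_or_pos N with rfl | hN
  · simp
  haveI : NeZero N := NeZero.of_pos hN
  obtain ⟨A, hAq, hA⟩ := exists_queries_eq_quantumQueryComplexityOn (N := N)
    (ε := 1 / 3) (by norm_num) Set.univ f
  have h := adversary_sum_le A hA hδ hδ1
  rw [hAq] at h
  exact h

end Literature.Computability.QuantumComplexity

end
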